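import Literature.Topology.FourManifolds.OneJetTransversality
import Literature.Topology.FourManifolds.IntrinsicFoldCriterion
import HarnessLib

/-!
# 1-jet transversality is invariant under diffeomorphisms of the target

Topic `Literature/Topology/FourManifolds` (programme of the fact
`Literature.Topology.FourManifolds.exists_isSimplifiedBrokenLefschetzFibration`, Baykur–Saeki 2017, §2.1).
`OneJetGenericMapsExist.isOneJetTransverseAt_comp_iff` transports the condition `j¹g ⋔ S₁`
(`OneJet.IsOneJetTransverseAt`) along reparametrisations of the SOURCE; this file does the
TARGET: for a map `ψ` that is `C²` at `g x` with invertible derivative `B`,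
`j¹(ψ ∘ g) ⋔ S₁` at `x` iff `j¹g ⋔ S₁` at `x` (`OneJet.isOneJetTransverseAt_comp_target_iff`).
By the second-order chain rule `D²(ψ ∘ g)(x)(v, k) = B D²g(x)(v, k) + D²ψ(g x)(dg v, dg k)`, whose
second term dies for `k ∈ Ker dg_x`; cokernel covectors correspond by `ℓ ↦ ℓ ∘ B⁻¹`.  Needed to
read the genericity conditions in rank-one coordinates `ψ ∘ g ∘ φ⁻¹ = (t, f(t, w))`.

Everything is proved; no definitions, no named facts (D-0026).

## References

* M. Golubitsky, V. Guillemin, *Stable Mappings and Their Singularities*, GTM 14 (1973), Ch. II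
  §4 (invariance of jet transversality under `Diff(X) × Diff(Y)`), Ch. VI §1. [GolubitskyGuillemin1973]
-/

noncomputable section

open Set Function Filter
open scoped ContDiff Topology

namespace Literature.Topology.FourManifolds

namespace OneJet

section Target

variable {E F F' : Type} [NormedAddCommGroup E] [NormedSpace ℝ E] [NormedAddCommGroup F]
  [NormedSpace ℝ F] [NormedAddCommGroup F'] [NormedSpace ℝ F']

/-- **1-jet transversality is invariant under local diffeomorphisms of the target.**  If `ψ` is
`C²` at `g x` with invertible derivative `B` there and `g` is `C²` at `x`, then `ψ ∘ g` is
1-jet-transverse at `x` iff `g` is. [cite: GolubitskyGuillemin1973, Ch. II §4; Ch. VI §1, Def. 1.5] -/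
theorem isOneJetTransverseAt_comp_target_iff {g : E → F} {ψ : F → F'} {x : E} (B : F ≃L[ℝ] F')
    (hψ : HasFDerivAt ψ (B : F →L[ℝ] F') (g x)) (hψ2 : ContDiffAt ℝ 2 ψ (g x))
    (hg2 : ContDiffAt ℝ 2 g x) :
    IsOneJetTransverseAt (ψ ∘ g) x ↔ IsOneJetTransverseAt g x := by
  have hgd : DifferentiableAt ℝ g x := hg2.differentiableAt (by simp)
  have hfd : fderiv ℝ (ψ ∘ g) x = (B : F →L[ℝ] F').comp (fderiv ℝ g x) := by
    rw [fderiv_comp x hψ.differentiableAt hgd, hψ.fderiv]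
  have hD2 : ∀ v w, fderiv ℝ (fderiv ℝ (ψ ∘ g)) x v w =
      B (fderiv ℝ (fderiv ℝ g) x v w) +
        fderiv ℝ (fderiv ℝ ψ) (g x) (fderiv ℝ g x v) (fderiv ℝ g x w) := fun v w => by
    rw [fderiv_fderiv_comp_apply_eq_add hψ2 hg2 v w, hψ.fderiv]
    rfl
  rw [isOneJetTransverseAt_iff, isOneJetTransverseAt_iff]
  constructor
  · intro h ℓ hℓ hℓg k hk hv
    -- the covector `ℓ ∘ B⁻¹` for `ψ ∘ g`
    have hℓ' : ℓ.comp (B.symm : F' →L[ℝ] F) ≠ 0 := by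
      intro h0
      apply hℓ
      ext w
      have := congrArg (fun φ : F' →L[ℝ] ℝ => φ (B w)) h0
      simpa using this
    have hℓg' : (ℓ.comp (B.symm : F' →L[ℝ] F)).comp (fderiv ℝ (ψ ∘ g) x) = 0 := by
      rw [hfd]
      ext w
      have := congrArg (fun φ : E →L[ℝ] ℝ => φ w) hℓg
      simpa using this
    have hk' : fderiv ℝ (ψ ∘ g) x k = 0 := by rw [hfd]; simp [hk]
    refine h _ hℓ' hℓg' k hk' fun v => ?_
    rw [hD2, hk, map_zero, map_add]
    simpa using hv v
  · intro h ℓ' hℓ' hℓg' k hk' hv'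
    -- the covector `ℓ' ∘ B` for `g`
    have hℓ : ℓ'.comp (B : F →L[ℝ] F') ≠ 0 := by
      intro h0
      apply hℓ'
      ext w
      have := congrArg (fun φ : F →L[ℝ] ℝ => φ (B.symm w)) h0
      simpa using this
    have hℓg : (ℓ'.comp (B : F →L[ℝ] F')).comp (fderiv ℝ g x) = 0 := by
      rw [ContinuousLinearMap.comp_assoc, ← hfd, hℓg']
    have hk : fderiv ℝ g x k = 0 := by
      have := hk'
      rw [hfd] at this
      exact B.injective (by simpa using this)
    refine h _ hℓ hℓg k hk fun v => ?_
    have h1 := hv' v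
    rw [hD2, hk, map_zero, add_zero] at h1
    simpa using h1

end Target

end OneJet

end Literature.Topology.FourManifolds
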